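import Mathlib
import HarnessLib
import Literature.Analysis.FluidPDE.ParabolicComparison
import Summits.NavierStokesRegularity.NavierStokesRegularity.Theorems.PoloidalWindowDoorPoloidalWindowRigidityTimeHeightShearLinearSlice
import Summits.NavierStokesRegularity.NavierStokesRegularity.Theorems.PoloidalWindowDoorPoloidalWindowRigiditySlopeFunctionPressure

/-!
# Item `LrcModEntire` (stmt-NavierStokesRegularity-20428), CLASS road to `stub_twistingTHGerm` — THE THREAD PLANE IS (WEAKLY) HYPERBOLIC:
# at the hot spot, `μ·Δₕv₂ ≥ 0`, so a non-degenerate horizontal Hessian forces `μ(−1,0) ≤ 0`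

Cell ns-regularity-ideate, LEAD ns-poloidal-K2-p3 g13 (`--supports stmt-NavierStokesRegularity-20428`; memo OSC-LIOUVILLE-g13 v1.5b §5septies: the wall (BRANCH) needs
non-degeneracy of the plane extremum at the thread; this file records what non-degeneracy gives for free).

THE POINT.  At the hot spot `(−1, 0)` of the registered stub (`√(−t)|v₂| ≤ |v₂(−1,0)|`, so `x = 0` is a global spatial extremum of `|v₂(−1,·)|`), every pure second
derivative of `θ = v₂(−1,·)` has the sign of `−θ(0)`: `θ(0)·∂_e∂_eθ(0) ≤ 0`.  On a (TH) plane the tree's linear slice identity `plane_wave_identity` reads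
`∂₂²θ = −μ·Δₕθ`.  Hence `μ·θ(0)·Δₕθ(0) ≥ 0`, and if the horizontal Laplacian is non-degenerate at the thread (`θ(0)·Δₕθ(0) < 0`) then `μ ≤ 0`:
* `mul_deriv_deriv_line_nonpos_of_isLocalMax_abs` — generic: `|G| ≤ |G(x)|` near `x`, `G ∈ C²` ⇒ `G(x)·∂_e∂_eG(x) ≤ 0` for every direction `e`;
* `hotSpot_slope_nonpos` — class + (TH) on the thread plane with slope `μ` + hot spot + `v₂(−1,0)·Δₕv₂(−1,0) < 0` ⇒ `μ ≤ 0` (the thread plane is hyperbolic or parabolic,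
  never elliptic).  So the hyperbolicity asked by the PINNED road is automatic AT THE THREAD under the non-degeneracy that (BRANCH) needs anyway.

WHAT THIS IS NOT: not a claim about Navier–Stokes regularity and not the stub (bears_on LADDER-NS N0, item 20428 / crux 19708; both OPEN).
-/

noncomputable section

-- the summit and its single sub-problem share the name (CONVENTIONS §1), as in every Theorems file
set_option linter.dupNamespace false

namespace Summit.NavierStokesRegularity.NavierStokesRegularity.Theorems.PoloidalWindowDoorLrcModEntireTwistingTHHotSpotSlope

open Set Filter Topology Function
open scoped RealInnerProductSpace
open Literature.Analysis Literature.Analysis.FluidPDE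
open Summit.NavierStokesRegularity.NavierStokesRegularity.Theorems.PoloidalWindowDoorPoloidalWindowRigidityTimeHeightShearLinearSlice
open Summit.NavierStokesRegularity.NavierStokesRegularity.Theorems.PoloidalWindowDoorPoloidalWindowRigidityClebsch
open Summit.NavierStokesRegularity.NavierStokesRegularity.Theorems.PoloidalWindowDoorPoloidalWindowRigidityConstantShearSlice
open Summit.NavierStokesRegularity.NavierStokesRegularity.Theorems.PoloidalWindowDoorPoloidalWindowRigiditySlopeFunctionPressure

/-! ### Generic: second derivatives at an extremum of `|G|` -/

/-- **At a local maximum of `|G|`, `G(x)·∂_e∂_eG(x) ≤ 0` in every direction.**  (If `G(x) > 0`, `x` is a local max of `G`, so the second derivative along the line is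
`≤ 0`; if `G(x) < 0`, a local min; if `G(x) = 0` the product vanishes.) -/
theorem mul_deriv_deriv_line_nonpos_of_isLocalMax_abs {G : EuclideanSpace ℝ (Fin 3) → ℝ} {x : EuclideanSpace ℝ (Fin 3)}
    (hG : ContDiff ℝ 2 G) (hmax : IsLocalMax (fun y => |G y|) x) (e : EuclideanSpace ℝ (Fin 3)) :
    G x * fderiv ℝ (fun y => fderiv ℝ G y e) x e ≤ 0 := by
  have hGd : Differentiable ℝ G := hG.differentiable (by norm_num)
  have hD1 : ContDiff ℝ 1 fun z => fderiv ℝ G z e := (hG.fderiv_right (m := 1) le_rfl).clm_apply contDiff_const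
  -- the line `σ ↦ x + σ e` and the second derivative along it
  have hline : Tendsto (fun σ : ℝ => x + σ • e) (𝓝 0) (𝓝 x) := by
    have h : Continuous (fun σ : ℝ => x + σ • e) := by fun_prop
    simpa using h.tendsto 0
  have key : ∀ (H : EuclideanSpace ℝ (Fin 3) → ℝ), ContDiff ℝ 2 H → IsLocalMax (fun y => H y) x →
      fderiv ℝ (fun y => fderiv ℝ H y e) x e ≤ 0 := by
    intro H hH hHmax
    have hHd : Differentiable ℝ H := hH.differentiable (by norm_num)
    set φ : ℝ → ℝ := fun σ => H (x + σ • e) with hφ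
    have hφ1 : deriv φ = fun σ => fderiv ℝ H (x + σ • e) e := funext fun σ => (hasDerivAt_comp_line hHd x e σ).deriv
    have hD : ContDiff ℝ 1 fun z => fderiv ℝ H z e := (hH.fderiv_right (m := 1) le_rfl).clm_apply contDiff_const
    have hφ2 : deriv (deriv φ) 0 = fderiv ℝ (fun y => fderiv ℝ H y e) x e := by
      rw [hφ1]
      have h2 := hasDerivAt_comp_line (hD.differentiable one_ne_zero) x e 0
      rw [zero_smul, add_zero] at h2
      exact h2.deriv
    have hφmax : IsLocalMax φ 0 := by
      have h := hline.eventually hHmax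
      refine h.mono fun σ hσ => ?_
      simpa [hφ] using hσ
    have hcφ : ContinuousAt φ 0 := (hHd.continuous.comp (by fun_prop)).continuousAt
    rw [← hφ2]
    exact IsLocalMax.deriv_deriv_nonpos hφmax hcφ
  rcases lt_trichotomy (G x) 0 with hneg | hzero | hpos
  · -- `G(x) < 0`: `x` is a local max of `−G`
    have hmax' : IsLocalMax (fun y => -G y) x := by
      have hnear : ∀ᶠ y in 𝓝 x, G y < 0 := hGd.continuous.continuousAt.eventually (gt_mem_nhds hneg)
      filter_upwards [hmax, hnear] with y hy hyneg
      have h1 : |G y| ≤ |G x| := hy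
      rw [abs_of_neg hyneg, abs_of_neg hneg] at h1
      linarith
    have h := key (fun y => -G y) hG.neg hmax'
    have e1 : (fun y => fderiv ℝ (fun y => -G y) y e) = fun y => -fderiv ℝ G y e := by
      funext y; simp [fderiv_fun_neg]
    rw [e1] at h
    have e2 : fderiv ℝ (fun y => -fderiv ℝ G y e) x e = -fderiv ℝ (fun y => fderiv ℝ G y e) x e := by
      have : (fun y => -fderiv ℝ G y e) = fun y => -(fun y => fderiv ℝ G y e) y := rfl
      rw [this, fderiv_fun_neg]; rfl
    rw [e2] at h
    nlinarith
  · rw [hzero, zero_mul]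
  · have hmax' : IsLocalMax G x := by
      have hnear : ∀ᶠ y in 𝓝 x, 0 < G y := hGd.continuous.continuousAt.eventually (lt_mem_nhds hpos)
      filter_upwards [hmax, hnear] with y hy hypos
      have h1 : |G y| ≤ |G x| := hy
      rw [abs_of_pos hypos, abs_of_pos hpos] at h1
      exact h1
    have h := key G hG hmax'
    nlinarith

/-! ### The thread plane of a class profile -/

section Class

variable {C : ℝ} {v : ℝ → EuclideanSpace ℝ (Fin 3) → EuclideanSpace ℝ (Fin 3)}
variable (hrate : HasTypeITimeDecay C v) (hcont : ContinuousOn (uncurry v) (Iio (0 : ℝ) ×ˢ univ))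
  (hmild : ∀ s t : ℝ, s < t → t < 0 → ∀ x,
    v t x = UnboundedOperators.heatExtension (v s) (t - s) x - oseenDuhamel 1 s v v t x)
  (hdiv : ∀ t < 0, VectorCalculus.IsDivFree (v t))

include hrate hcont hmild hdiv

/-- **THE THREAD PLANE IS NOT ELLIPTIC (unless degenerate).**  Let `v` be a class profile with the hot-spot normalisation `√(−t)|v₂(t,x)| ≤ |v₂(−1,0)|`, and let the plane
`{y₂ = 0}` of the slice `−1` be proportional-shear with slope `μ`.  Then `μ·(∂₀²v₂ + ∂₁²v₂)(−1,0)·v₂(−1,0) ≥ 0`; in particular, if the horizontal Laplacian of `v₂` is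
non-degenerate at the thread (`Δₕv₂(−1,0) ≠ 0`, i.e. `v₂(−1,0)·Δₕv₂(−1,0) < 0`), then **`μ ≤ 0`** — the thread plane is hyperbolic or parabolic, never elliptic.
Proof: `∂₂²θ = −μΔₕθ` on the plane (`plane_wave_identity`), and `θ(0)·∂₂²θ(0) ≤ 0`, `θ(0)·Δₕθ(0) ≤ 0` at an extremum of `|θ|`. -/
theorem hotSpot_slope_nonpos {μ : ℝ}
    (hhot : ∀ t < 0, ∀ x, Real.sqrt (-t) * |v t x 2| ≤ |v (-1) 0 2|)
    (hslope : ∀ y : EuclideanSpace ℝ (Fin 3), y 2 = 0 → ∀ b : Fin 3, b ≠ 2 →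
      fderiv ℝ (v (-1)) y (EuclideanSpace.single 2 1) b = μ * fderiv ℝ (v (-1)) y (EuclideanSpace.single b 1) 2)
    (hnd : v (-1) 0 2 *
      (fderiv ℝ (fun y => fderiv ℝ (fun y' => v (-1) y' 2) y (EuclideanSpace.single 0 (1 : ℝ))) 0 (EuclideanSpace.single 0 (1 : ℝ)) +
       fderiv ℝ (fun y => fderiv ℝ (fun y' => v (-1) y' 2) y (EuclideanSpace.single 1 (1 : ℝ))) 0 (EuclideanSpace.single 1 (1 : ℝ))) < 0) :
    μ ≤ 0 := by
  have hs : (-1 : ℝ) < 0 := by norm_num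
  have hu : ContDiff ℝ 2 (v (-1)) := (contDiff_slice hrate hcont hmild hs).of_le (by norm_cast)
  have hθ2 : ContDiff ℝ 2 (fun y : EuclideanSpace ℝ (Fin 3) => v (-1) y 2) :=
    (contDiff_vert_slice hrate hcont hmild hdiv hs).of_le (by norm_cast)
  -- `|θ|` has a (global) maximum at `0`
  have hmax : IsLocalMax (fun y : EuclideanSpace ℝ (Fin 3) => |v (-1) y 2|) 0 :=
    Filter.Eventually.of_forall fun y => by simpa using hhot (-1) hs y
  -- second derivatives at the extremum of `|θ|`
  have h2 := mul_deriv_deriv_line_nonpos_of_isLocalMax_abs hθ2 hmax (EuclideanSpace.single 2 (1 : ℝ))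
  -- the plane wave identity at the thread
  have hwave := plane_wave_identity hu (fun x => div_coord (hdiv (-1) hs) x) hslope (x := 0) (by simp)
  rw [hwave] at h2
  -- `θ(0)·(−μ·Δₕθ(0)) ≤ 0` and `θ(0)·Δₕθ(0) < 0` ⇒ `μ ≤ 0`
  nlinarith [h2, hnd]

end Class

end Summit.NavierStokesRegularity.NavierStokesRegularity.Theorems.PoloidalWindowDoorLrcModEntireTwistingTHHotSpotSlope
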